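import Summits.NavierStokesRegularity.FunctionalMining.TopEigTransportRate
import HarnessLib

/-!
# FunctionalMining — the exact balance of the `λ₁` moment along Navier–Stokes: dissipation
# plus a transport-free, selection-free Euler production (two-sided sandwich)

Search for candidate a priori estimates; no regularity claim. Cell `pub-nsfunc`, prove seat
(gen 24). The exact one-sided production rate of `Φ_q(u) = ∫(λ₁⁺)^q(S(u))` along a classical
solution of `∂ₜu + (u·∇)u = νΔu − ∇p + f`, `div u = 0` on `T^d × [a, b]` is, after LEMMA ADV
(`TopEigTransportRate`), the transport-free Danskin integral
`R(t) = ∫ q λ₁^{q−1} μ(S; νΔS + H) dx`, `H := −Π(p) + S(f) − N(u)` (`μ(A; M) = dirTopEig A M` the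
largest value of `eᵀMe` over unit top vectors of `A`; `Π` the pressure-Hessian vector `pressVec`,
`N(u)` the quadratic term `nonlinVec`). The functional `M ↦ μ(A; M)` is convex, not additive; its
subadditivity and a test with a heat-maximal top vector sandwich `R(t)` between two DATUM
functionals:

* `TopEig.dirTopEig_smul_add_le_of_nonneg` — `μ(A; νL + X) ≤ ν μ(A; L) + μ(A; X)` (`ν ≥ 0`);
  `TopEig.smul_dirTopEig_sub_neg_le_dirTopEig_smul_add` — `ν μ(A; L) − μ(A; −X) ≤ μ(A; νL + X)`
  (every real `ν`);
* **`TopEig.topEigMoment_rate_le_heat_add_production`** /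
  **`TopEig.topEigMoment_rate_ge_heat_sub_production`** — for `ν ≥ 0`, `q ≥ 1`, `t ∈ [a, b)`:
  `−ν T_q(u(t)) − 𝒩₋(t) ≤ R(t) ≤ −ν T_q(u(t)) + 𝒩₊(t)` with the heat dissipation
  `T_q = heatDissipation Φ_q ≥ 0` of the slice (Danskin: `−∫ q λ₁^{q−1} μ(S; ΔS)`,
  `TopEigHeatDanskin`) and the transport-free, selection-free Euler productions
  `𝒩₊(t) := ∫ q λ₁^{q−1} μ(S; −Π(p) + S(f) − N(u))`, `𝒩₋(t) := ∫ q λ₁^{q−1} μ(S; Π(p) − S(f) + N(u))`;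
* **`TopEig.hasDerivWithinAt_topEigMoment_le_heat_add_production`** — packaged: `s ↦ Φ_q(u(s))`
  has at `t` a right derivative `R` with the two-sided sandwich;
* **`TopEig.topEigMoment_initialRate_le_of_datum`** — UNFORCED solutions, at the initial time and
  within `[a, b]` (the shape of the tree's `HasInitialRate` / `SaturatingLawSup` clauses): the right
  derivative `R` of `Φ_q(u(s))` at `s = a` satisfies
  `R ≤ −ν T_q(w) + ∫ q λ₁^{q−1} μ(S(w); −Π(π_w) − N(w))`, `w := u(a)`, `π_w = pressureOf w` the
  datum's own pressure — BOTH terms are functionals of the datum alone ("the dangerous term" of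
  the `λ₁` rows is `𝒩₊(w) = ∫ q λ₁^{q−1} μ(S; −Π(π_w) − N(w))`, with no transport and no selection);
  and `…_ge_of_datum`: `−ν T_q(w) − ∫ q λ₁^{q−1} μ(S(w); Π(π_w) + N(w)) ≤ R`.

Refutation/estimate BOOKKEEPING for the CANDIDATE rows `ES.lam1.q`: this is the exact `dF/dt`
computation with the dangerous term isolated; no bound on `𝒩₊` is claimed and nothing here is
about Navier–Stokes regularity. [ours; Danskin folklore]
-/

noncomputable section

open MeasureTheory Set Filter Topology

namespace Summit.NavierStokesRegularity.FunctionalMining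

open Literature.Analysis.FunctionSpaces Literature.Analysis.FluidPDE

namespace TopEig

open StrainL4 StrainTensor

variable {d : Type*} [Fintype d] [DecidableEq d] [Nonempty d]

/-! ## 1. The Danskin functional against a sum: subadditive above, heat-maximal test below -/

/-- `μ(A; νL + X) ≤ ν μ(A; L) + μ(A; X)` for `ν ≥ 0` (subadditivity and positive homogeneity).
[folklore] -/
theorem dirTopEig_smul_add_le_of_nonneg {ν : ℝ} (hν : 0 ≤ ν) (A L X : EuclideanSpace ℝ (d × d)) :
    dirTopEig A (ν • L + X) ≤ ν * dirTopEig A L + dirTopEig A X := by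
  have h := dirTopEig_add_le A (ν • L) X
  rwa [dirTopEig_smul_of_nonneg hν] at h

/-- `ν μ(A; L) − μ(A; −X) ≤ μ(A; νL + X)` for every real `ν` (test `νL + X` with a top vector `e`
attaining `μ(A; L)`: `eᵀ(νL)e = ν μ(A; L)` exactly, and `eᵀXe = −eᵀ(−X)e ≥ −μ(A; −X)`). [folklore] -/
theorem smul_dirTopEig_sub_neg_le_dirTopEig_smul_add (ν : ℝ) (A L X : EuclideanSpace ℝ (d × d)) :
    ν * dirTopEig A L - dirTopEig A (-X) ≤ dirTopEig A (ν • L + X) := by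
  obtain ⟨e, he, hq⟩ := exists_quad_eq_dirTopEig A L
  have h1 := quad_le_dirTopEig (ν • L + X) he
  have h2 := quad_le_dirTopEig (-X) he
  have h3 : quad (-X) e = -quad X e := by rw [← neg_one_smul ℝ X, quad_smul, neg_one_mul]
  rw [quad_add, quad_smul, hq] at h1
  linarith

/-! ## 2. The two-sided sandwich of the exact rate along Navier–Stokes -/

variable {q : ℝ}

/-- **Upper half of the balance.** Along a classical solution on `T^d × [a, b]` with `ν ≥ 0`,
`q ≥ 1`, `t ∈ [a, b)`: the transport-free rate satisfies
`∫ q λ₁^{q−1} μ(S; νΔS − Π(p) + S(f) − N(u)) ≤ −ν T_q(u(t)) + ∫ q λ₁^{q−1} μ(S; −Π(p) + S(f) − N(u))`.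
[ours] -/
theorem topEigMoment_rate_le_heat_add_production {a b ν : ℝ} (hν : 0 ≤ ν)
    {f u : ℝ → UnitAddTorus d → EuclideanSpace ℝ d} {p : ℝ → UnitAddTorus d → ℝ}
    (h : Torus.IsClassicalNSSolutionOn (Icc a b) ν f u p) (hab : a < b) (hq : 1 ≤ q) {t : ℝ}
    (ht : t ∈ Ico a b) :
    ∫ x, q * torusStrainTopEig (u t) x ^ (q - 1) *
        dirTopEig (strainFlat (u t) x)
          (ν • Torus.laplacian (strainFlat (u t)) x - pressVec (p t) x +
            strainFlat (f t) x - nonlinVec (u t) x) ≤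
      -(ν * heatDissipation (torusTopEigMoment q) (u t)) +
        ∫ x, q * torusStrainTopEig (u t) x ^ (q - 1) *
          dirTopEig (strainFlat (u t) x) (-pressVec (p t) x + strainFlat (f t) x - nonlinVec (u t) x) := by
  have ht' : t ∈ Icc a b := ⟨ht.1, ht.2.le⟩
  have hu : Torus.IsSmooth (u t) := h.smooth_velocity.isSmooth_slice ht'
  have hdu : Torus.IsDivFree (u t) := h.divFree t ht'
  have hp : Torus.IsSmooth (p t) := h.smooth_pressure.isSmooth_slice ht'
  have hf : Torus.IsSmooth (f t) := (h.smooth_force (uniqueDiffOn_Icc hab)).isSmooth_slice ht'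
  have hH : Continuous fun x => -pressVec (p t) x + strainFlat (f t) x - nonlinVec (u t) x :=
    ((isSmooth_pressVec hp).continuous.neg.add (continuous_strainFlat hf)).sub
      (isSmooth_nonlinVec hu).continuous
  have hL : Continuous fun x => Torus.laplacian (strainFlat (u t)) x :=
    (isSmooth_strainFlat hu).laplacian.continuous
  have hint_tot : Integrable (fun x => q * torusStrainTopEig (u t) x ^ (q - 1) *
      dirTopEig (strainFlat (u t) x) (ν • Torus.laplacian (strainFlat (u t)) x - pressVec (p t) x +
        strainFlat (f t) x - nonlinVec (u t) x)) volume :=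
    integrable_topEigDensity hq hu hdu ((((hL.const_smul ν).sub (isSmooth_pressVec hp).continuous).add
      (continuous_strainFlat hf)).sub (isSmooth_nonlinVec hu).continuous)
  have hint_L : Integrable (fun x => q * torusStrainTopEig (u t) x ^ (q - 1) *
      dirTopEig (strainFlat (u t) x) (Torus.laplacian (strainFlat (u t)) x)) volume :=
    integrable_topEigDensity hq hu hdu hL
  have hint_H : Integrable (fun x => q * torusStrainTopEig (u t) x ^ (q - 1) *
      dirTopEig (strainFlat (u t) x) (-pressVec (p t) x + strainFlat (f t) x - nonlinVec (u t) x)) volume :=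
    integrable_topEigDensity hq hu hdu hH
  -- Danskin's formula for the heat dissipation of the slice, with `S(Δu) = ΔS`
  have hT : heatDissipation (torusTopEigMoment q) (u t) =
      -∫ x, q * torusStrainTopEig (u t) x ^ (q - 1) *
        dirTopEig (strainFlat (u t) x) (Torus.laplacian (strainFlat (u t)) x) := by
    rw [heatDissipation_topEigMoment_eq_integral hq hu hdu]
    simp only [strainFlat_laplacian hu]
  rw [hT, mul_neg, neg_neg, ← integral_const_mul, ← integral_add (hint_L.const_mul ν) hint_H]
  refine integral_mono hint_tot ((hint_L.const_mul ν).add hint_H) fun x => ?_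
  have hl : 0 ≤ torusStrainTopEig (u t) x := by
    rw [← lam_strainFlat]; exact lam_strainFlat_nonneg hu hdu x
  have hW : 0 ≤ q * torusStrainTopEig (u t) x ^ (q - 1) := mul_nonneg (by linarith) (Real.rpow_nonneg hl _)
  have hpt := dirTopEig_smul_add_le_of_nonneg hν (strainFlat (u t) x)
    (Torus.laplacian (strainFlat (u t)) x) (-pressVec (p t) x + strainFlat (f t) x - nonlinVec (u t) x)
  have e1 : ν • Torus.laplacian (strainFlat (u t)) x - pressVec (p t) x + strainFlat (f t) x -
      nonlinVec (u t) x = ν • Torus.laplacian (strainFlat (u t)) x +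
      (-pressVec (p t) x + strainFlat (f t) x - nonlinVec (u t) x) := by abel
  calc q * torusStrainTopEig (u t) x ^ (q - 1) * dirTopEig (strainFlat (u t) x)
        (ν • Torus.laplacian (strainFlat (u t)) x - pressVec (p t) x + strainFlat (f t) x - nonlinVec (u t) x)
      ≤ q * torusStrainTopEig (u t) x ^ (q - 1) *
          (ν * dirTopEig (strainFlat (u t) x) (Torus.laplacian (strainFlat (u t)) x) +
            dirTopEig (strainFlat (u t) x) (-pressVec (p t) x + strainFlat (f t) x - nonlinVec (u t) x)) := by
        rw [e1]; exact mul_le_mul_of_nonneg_left hpt hW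
    _ = ν * (q * torusStrainTopEig (u t) x ^ (q - 1) *
          dirTopEig (strainFlat (u t) x) (Torus.laplacian (strainFlat (u t)) x)) +
        q * torusStrainTopEig (u t) x ^ (q - 1) *
          dirTopEig (strainFlat (u t) x) (-pressVec (p t) x + strainFlat (f t) x - nonlinVec (u t) x) := by
        ring

/-- **Lower half of the balance.** Along a classical solution on `T^d × [a, b]` (any real `ν`),
`q ≥ 1`, `t ∈ [a, b)`:
`−ν T_q(u(t)) − ∫ q λ₁^{q−1} μ(S; Π(p) − S(f) + N(u)) ≤ ∫ q λ₁^{q−1} μ(S; νΔS − Π(p) + S(f) − N(u))`.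
[ours] -/
theorem topEigMoment_rate_ge_heat_sub_production {a b ν : ℝ}
    {f u : ℝ → UnitAddTorus d → EuclideanSpace ℝ d} {p : ℝ → UnitAddTorus d → ℝ}
    (h : Torus.IsClassicalNSSolutionOn (Icc a b) ν f u p) (hab : a < b) (hq : 1 ≤ q) {t : ℝ}
    (ht : t ∈ Ico a b) :
    -(ν * heatDissipation (torusTopEigMoment q) (u t)) -
        ∫ x, q * torusStrainTopEig (u t) x ^ (q - 1) *
          dirTopEig (strainFlat (u t) x) (pressVec (p t) x - strainFlat (f t) x + nonlinVec (u t) x) ≤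
      ∫ x, q * torusStrainTopEig (u t) x ^ (q - 1) *
        dirTopEig (strainFlat (u t) x)
          (ν • Torus.laplacian (strainFlat (u t)) x - pressVec (p t) x +
            strainFlat (f t) x - nonlinVec (u t) x) := by
  have ht' : t ∈ Icc a b := ⟨ht.1, ht.2.le⟩
  have hu : Torus.IsSmooth (u t) := h.smooth_velocity.isSmooth_slice ht'
  have hdu : Torus.IsDivFree (u t) := h.divFree t ht'
  have hp : Torus.IsSmooth (p t) := h.smooth_pressure.isSmooth_slice ht'
  have hf : Torus.IsSmooth (f t) := (h.smooth_force (uniqueDiffOn_Icc hab)).isSmooth_slice ht'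
  have hHm : Continuous fun x => pressVec (p t) x - strainFlat (f t) x + nonlinVec (u t) x :=
    (((isSmooth_pressVec hp).continuous).sub (continuous_strainFlat hf)).add
      (isSmooth_nonlinVec hu).continuous
  have hL : Continuous fun x => Torus.laplacian (strainFlat (u t)) x :=
    (isSmooth_strainFlat hu).laplacian.continuous
  have hint_tot : Integrable (fun x => q * torusStrainTopEig (u t) x ^ (q - 1) *
      dirTopEig (strainFlat (u t) x) (ν • Torus.laplacian (strainFlat (u t)) x - pressVec (p t) x +
        strainFlat (f t) x - nonlinVec (u t) x)) volume :=
    integrable_topEigDensity hq hu hdu ((((hL.const_smul ν).sub (isSmooth_pressVec hp).continuous).add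
      (continuous_strainFlat hf)).sub (isSmooth_nonlinVec hu).continuous)
  have hint_L : Integrable (fun x => q * torusStrainTopEig (u t) x ^ (q - 1) *
      dirTopEig (strainFlat (u t) x) (Torus.laplacian (strainFlat (u t)) x)) volume :=
    integrable_topEigDensity hq hu hdu hL
  have hint_Hm : Integrable (fun x => q * torusStrainTopEig (u t) x ^ (q - 1) *
      dirTopEig (strainFlat (u t) x) (pressVec (p t) x - strainFlat (f t) x + nonlinVec (u t) x)) volume :=
    integrable_topEigDensity hq hu hdu hHm
  have hT : heatDissipation (torusTopEigMoment q) (u t) =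
      -∫ x, q * torusStrainTopEig (u t) x ^ (q - 1) *
        dirTopEig (strainFlat (u t) x) (Torus.laplacian (strainFlat (u t)) x) := by
    rw [heatDissipation_topEigMoment_eq_integral hq hu hdu]
    simp only [strainFlat_laplacian hu]
  rw [hT, mul_neg, neg_neg, ← integral_const_mul, ← integral_sub (hint_L.const_mul ν) hint_Hm]
  refine integral_mono ((hint_L.const_mul ν).sub hint_Hm) hint_tot fun x => ?_
  have hl : 0 ≤ torusStrainTopEig (u t) x := by
    rw [← lam_strainFlat]; exact lam_strainFlat_nonneg hu hdu x
  have hW : 0 ≤ q * torusStrainTopEig (u t) x ^ (q - 1) := mul_nonneg (by linarith) (Real.rpow_nonneg hl _)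
  have hpt := smul_dirTopEig_sub_neg_le_dirTopEig_smul_add ν (strainFlat (u t) x)
    (Torus.laplacian (strainFlat (u t)) x) (-pressVec (p t) x + strainFlat (f t) x - nonlinVec (u t) x)
  have e1 : ν • Torus.laplacian (strainFlat (u t)) x - pressVec (p t) x + strainFlat (f t) x -
      nonlinVec (u t) x = ν • Torus.laplacian (strainFlat (u t)) x +
      (-pressVec (p t) x + strainFlat (f t) x - nonlinVec (u t) x) := by abel
  have e2 : -(-pressVec (p t) x + strainFlat (f t) x - nonlinVec (u t) x) =
      pressVec (p t) x - strainFlat (f t) x + nonlinVec (u t) x := by abel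
  rw [e2] at hpt
  calc ν * (q * torusStrainTopEig (u t) x ^ (q - 1) *
          dirTopEig (strainFlat (u t) x) (Torus.laplacian (strainFlat (u t)) x)) -
        q * torusStrainTopEig (u t) x ^ (q - 1) *
          dirTopEig (strainFlat (u t) x) (pressVec (p t) x - strainFlat (f t) x + nonlinVec (u t) x)
      = q * torusStrainTopEig (u t) x ^ (q - 1) *
          (ν * dirTopEig (strainFlat (u t) x) (Torus.laplacian (strainFlat (u t)) x) -
            dirTopEig (strainFlat (u t) x) (pressVec (p t) x - strainFlat (f t) x + nonlinVec (u t) x)) := by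
        ring
    _ ≤ q * torusStrainTopEig (u t) x ^ (q - 1) * dirTopEig (strainFlat (u t) x)
        (ν • Torus.laplacian (strainFlat (u t)) x - pressVec (p t) x + strainFlat (f t) x -
          nonlinVec (u t) x) := by
        rw [e1]; exact mul_le_mul_of_nonneg_left hpt hW

/-- **The exact balance of the `λ₁` moment, packaged.** Along a classical solution on
`T^d × [a, b]` with `ν ≥ 0`, `q ≥ 1`, `t ∈ [a, b)`: `s ↦ Φ_q(u(s))` has at `t` a RIGHT derivative `R`
with `−ν T_q(u(t)) − 𝒩₋(t) ≤ R ≤ −ν T_q(u(t)) + 𝒩₊(t)`, the heat dissipation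
`T_q = heatDissipation Φ_q` of the slice and the transport-free, selection-free Euler productions
`𝒩₊ = ∫ q λ₁^{q−1} μ(S; −Π(p) + S(f) − N(u))`, `𝒩₋ = ∫ q λ₁^{q−1} μ(S; Π(p) − S(f) + N(u))`.
Search for candidate a priori estimates; no regularity claim — no bound on `𝒩₊` is asserted. [ours] -/
theorem hasDerivWithinAt_topEigMoment_le_heat_add_production {a b ν : ℝ} (hν : 0 ≤ ν)
    {f u : ℝ → UnitAddTorus d → EuclideanSpace ℝ d} {p : ℝ → UnitAddTorus d → ℝ}
    (h : Torus.IsClassicalNSSolutionOn (Icc a b) ν f u p) (hab : a < b) (hq : 1 ≤ q) {t : ℝ}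
    (ht : t ∈ Ico a b) :
    ∃ R : ℝ, HasDerivWithinAt (fun s => torusTopEigMoment q (u s)) R (Set.Ioi t) t ∧
      R ≤ -(ν * heatDissipation (torusTopEigMoment q) (u t)) +
        ∫ x, q * torusStrainTopEig (u t) x ^ (q - 1) *
          dirTopEig (strainFlat (u t) x) (-pressVec (p t) x + strainFlat (f t) x - nonlinVec (u t) x) ∧
      -(ν * heatDissipation (torusTopEigMoment q) (u t)) -
        ∫ x, q * torusStrainTopEig (u t) x ^ (q - 1) *
          dirTopEig (strainFlat (u t) x) (pressVec (p t) x - strainFlat (f t) x + nonlinVec (u t) x) ≤ R :=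
  ⟨_, hasDerivWithinAt_topEigMoment_navierStokes_transportFree hab h hq ht,
    topEigMoment_rate_le_heat_add_production hν h hab hq ht,
    topEigMoment_rate_ge_heat_sub_production h hab hq ht⟩

/-! ## 3. Unforced solutions: the initial rate is controlled by the datum alone -/

/-- **The dangerous term of the `λ₁` rows, isolated at the datum.** Along every classical solution
of UNFORCED Navier–Stokes (`ν ≥ 0`) on `T^d × [a, b]`, `a < b`, `q ≥ 1`, with datum `w := u(a)`:
`s ↦ Φ_q(u(s))` has at `s = a` a right derivative `R` within `[a, b]` with
`R ≤ −ν T_q(w) + ∫ q λ₁^{q−1} μ(S(w); −Π(π_w) − N(w))`, where `π_w = pressureOf w` is the datum's own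
pressure (`pressureOf_eq_pressure_sub_integral`; additive constants are invisible to `Π`): BOTH
terms on the right are functionals of the datum, `T_q(w) ≥ 0` is the heat dissipation and the
integral is the transport-free, selection-free Euler production `𝒩₊(w)`. Search for candidate a
priori estimates; no regularity claim — no bound on `𝒩₊(w)` is asserted. [ours] -/
theorem topEigMoment_initialRate_le_of_datum {a b ν : ℝ} (hν : 0 ≤ ν) (hab : a < b)
    {u : ℝ → UnitAddTorus d → EuclideanSpace ℝ d} {p : ℝ → UnitAddTorus d → ℝ}
    (h : Torus.IsClassicalNSSolutionOn (Icc a b) ν 0 u p) (hq : 1 ≤ q) :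
    ∃ R : ℝ, HasDerivWithinAt (fun s => torusTopEigMoment q (u s)) R (Icc a b) a ∧
      R ≤ -(ν * heatDissipation (torusTopEigMoment q) (u a)) +
        ∫ x, q * torusStrainTopEig (u a) x ^ (q - 1) *
          dirTopEig (strainFlat (u a) x) (-pressVec (pressureOf (u a)) x - nonlinVec (u a) x) ∧
      -(ν * heatDissipation (torusTopEigMoment q) (u a)) -
        ∫ x, q * torusStrainTopEig (u a) x ^ (q - 1) *
          dirTopEig (strainFlat (u a) x) (pressVec (pressureOf (u a)) x + nonlinVec (u a) x) ≤ R := by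
  have ha : a ∈ Icc a b := left_mem_Icc.2 hab.le
  have hP : ∀ x, pressVec (p a) x = pressVec (pressureOf (u a)) x := fun x => by
    rw [pressureOf_eq_pressure_sub_integral h hab ha, pressVec_sub_const]
  have h0 : ∀ x, strainFlat ((0 : ℝ → UnitAddTorus d → EuclideanSpace ℝ d) a) x = 0 := fun x => by
    rw [Pi.zero_apply, strainFlat_zero]
  have eP : ∫ x, q * torusStrainTopEig (u a) x ^ (q - 1) * dirTopEig (strainFlat (u a) x)
      (-pressVec (p a) x + strainFlat ((0 : ℝ → UnitAddTorus d → EuclideanSpace ℝ d) a) x -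
        nonlinVec (u a) x) = ∫ x, q * torusStrainTopEig (u a) x ^ (q - 1) *
      dirTopEig (strainFlat (u a) x) (-pressVec (pressureOf (u a)) x - nonlinVec (u a) x) :=
    integral_congr_ae (ae_of_all _ fun x => by simp only [hP, h0, add_zero])
  have eM : ∫ x, q * torusStrainTopEig (u a) x ^ (q - 1) * dirTopEig (strainFlat (u a) x)
      (pressVec (p a) x - strainFlat ((0 : ℝ → UnitAddTorus d → EuclideanSpace ℝ d) a) x +
        nonlinVec (u a) x) = ∫ x, q * torusStrainTopEig (u a) x ^ (q - 1) *
      dirTopEig (strainFlat (u a) x) (pressVec (pressureOf (u a)) x + nonlinVec (u a) x) :=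
    integral_congr_ae (ae_of_all _ fun x => by simp only [hP, h0, sub_zero])
  refine ⟨_, hasDerivWithinAt_topEigMoment_navierStokes_transportFree_Icc hab h hq, ?_, ?_⟩
  · have h1 := topEigMoment_rate_le_heat_add_production hν h hab hq ⟨le_rfl, hab⟩
    rw [eP] at h1
    exact h1
  · have h1 := topEigMoment_rate_ge_heat_sub_production h hab hq ⟨le_rfl, hab⟩
    rw [eM] at h1
    exact h1

end TopEig

end Summit.NavierStokesRegularity.FunctionalMining

end
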